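import Literature.Topology.FourManifolds.ThickenedHandlebodyFour
import HarnessLib

/-!
# Thickened planar domains in `ℝ⁵`: the `5`-dimensional `1`-handlebodies
# `{q(x, y) + z² + w² + v² ≤ c} ⊂ ℝ⁵`

Topic `Literature/Topology/FourManifolds`; fact seat
`provefact-Literature.Topology.FourManifolds.IsPres-e086f60af2` (Andrews–Curtis 1965: the
presentation 5-manifolds `H⁵(P, ε)` of `PresentationHandlebodyFive.lean` are built on compact
connected orientable `5`-manifolds with boundary `V` with a handle decomposition into one
`0`-handle and `r` `1`-handles, classically `♮ʳ(S¹ × B⁴)`; by the tree's classification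
`nonempty_diffeomorph_of_hasHandleDecomposition_handleCount_one_of_handles'` — both handle
lemmas L0, L1 being discharged — any two such `V` of the same genus are diffeomorphic, so one
explicit model per genus carries every explicit construction on them: meridians, belt spheres,
cancelling pairs).  This file provides the models as **regular sublevel sets of thrice-thickened
planar Morse functions**, `G(x, y, z, w, v) = q(x, y) + z² + w² + v²`, exactly as
`ThickenedHandlebodyFour.lean` provides `{q(x, y) + z² + w² ≤ c} ⊂ ℝ⁴` one dimension lower
(and `ThickenedPlanarHandlebody.lean` the genus-`g` handlebodies `{q + z² ≤ c} ⊂ ℝ³`): §§1–3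
repeat the calculus of the thickening `F(x, y, z, w) + v²` of a function on `ℝ⁴`
(`SolidThickeningFive.thicken₅`: derivative, critical points `(crit F) × {0}`, Hessian, Morse
property, **unchanged Morse index** by the signature lemma `sigNeg_eq_of_proj`), and §4 applies
them to `F = q + z² + w²` for a planar Morse function `q` presenting a disc with `g` holes
(`IsHoledDiscMorseFunction g q c`, which exist for every `g`,
`exists_isHoledDiscMorseFunction`, Milnor 1965, Lemma 8.2): **`{q + z² + w² + v² ≤ c} ⊂ ℝ⁵` is a
compact connected orientable `5`-manifold with boundary with a handle decomposition into one
`0`-handle and `g` `1`-handles** (`IsHoledDiscMorseFunction.FiveThickening`,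
`hasHandleDecomposition_fiveThickening`), so that such `5`-manifolds exist in every genus
(`exists_oneHandlebody_five`; Kosinski 1993, VI §11: the `(5, 1)`-handlebodies; Kirby 1989,
Ch. I, p. 18: `♮ʳ(S¹ × B⁴) = B⁵ ∪ r` 1-handles).  Everything here is **proved**; no definitions
beyond the model maps, no named facts.

## References

* A. A. Kosinski, *Differential Manifolds* (1993), VI §11, (11.4)(c). [Kosinski1993]
* R. C. Kirby, *The topology of 4-manifolds*, LNM 1374 (1989), Ch. I, p. 18. [Kirby1989]
* J. Milnor, *Morse theory* (1963), §2, §3 (Thms. 3.1–3.2). [Milnor1963]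
* J. Milnor, *Lectures on the h-cobordism theorem* (1965), Lemma 8.2. [MilnorHCobordism1965]
-/

open scoped Manifold ContDiff Topology InnerProductSpace
open Set Function Filter Metric Module

noncomputable section

namespace Literature.Topology.FourManifolds

universe u

/-- Local notation: `𝔼 n` is the model Euclidean space `EuclideanSpace ℝ (Fin n)`. -/
local notation "𝔼 " n:arg => EuclideanSpace ℝ (Fin n)

/-! ### §1 The projection `ℝ⁵ → ℝ⁴`, the lift `ℝ⁴ → ℝ⁵` and the thickening `F(x, y, z, w) + v²` -/

namespace SolidThickeningFive

/-- The projection `π(x, y, z, w, v) = (x, y, z, w)` as a continuous linear map `ℝ⁵ → ℝ⁴`.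
[folklore] -/
def projFour : 𝔼 5 →L[ℝ] 𝔼 4 :=
  LinearMap.toContinuousLinearMap
    { toFun := fun p => WithLp.toLp 2 ![p 0, p 1, p 2, p 3]
      map_add' := fun p p' => by ext i; fin_cases i <;> simp
      map_smul' := fun a p => by ext i; fin_cases i <;> simp }

/-- `(π p)₀ = p₀`. [folklore] -/
@[simp] theorem projFour_apply_zero (p : 𝔼 5) : projFour p 0 = p 0 := rfl

/-- `(π p)₁ = p₁`. [folklore] -/
@[simp] theorem projFour_apply_one (p : 𝔼 5) : projFour p 1 = p 1 := rfl

/-- `(π p)₂ = p₂`. [folklore] -/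
@[simp] theorem projFour_apply_two (p : 𝔼 5) : projFour p 2 = p 2 := rfl

/-- `(π p)₃ = p₃`. [folklore] -/
@[simp] theorem projFour_apply_three (p : 𝔼 5) : projFour p 3 = p 3 := rfl

/-- The lift `ι(x, y, z, w) = (x, y, z, w, 0)` as a continuous linear map `ℝ⁴ → ℝ⁵`. [folklore] -/
def liftFour : 𝔼 4 →L[ℝ] 𝔼 5 :=
  LinearMap.toContinuousLinearMap
    { toFun := fun u => WithLp.toLp 2 ![u 0, u 1, u 2, u 3, 0]
      map_add' := fun u u' => by ext i; fin_cases i <;> simp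
      map_smul' := fun a u => by ext i; fin_cases i <;> simp }

/-- `(ι u)₀ = u₀`. [folklore] -/
@[simp] theorem liftFour_apply_zero (u : 𝔼 4) : liftFour u 0 = u 0 := rfl

/-- `(ι u)₁ = u₁`. [folklore] -/
@[simp] theorem liftFour_apply_one (u : 𝔼 4) : liftFour u 1 = u 1 := rfl

/-- `(ι u)₂ = u₂`. [folklore] -/
@[simp] theorem liftFour_apply_two (u : 𝔼 4) : liftFour u 2 = u 2 := rfl

/-- `(ι u)₃ = u₃`. [folklore] -/
@[simp] theorem liftFour_apply_three (u : 𝔼 4) : liftFour u 3 = u 3 := rfl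

/-- `(ι u)₄ = 0`. [folklore] -/
@[simp] theorem liftFour_apply_four (u : 𝔼 4) : liftFour u 4 = 0 := rfl

/-- `π ∘ ι = id`. [folklore] -/
@[simp] theorem projFour_liftFour (u : 𝔼 4) : projFour (liftFour u) = u := by
  ext i; fin_cases i <;> rfl

/-- The fifth basis vector `e₄ = (0, 0, 0, 0, 1)`. [folklore] -/
def ev : 𝔼 5 := WithLp.toLp 2 ![0, 0, 0, 0, 1]

/-- `(e₄)₀ = 0`. [folklore] -/
@[simp] theorem ev_apply_zero : ev 0 = 0 := rfl

/-- `(e₄)₁ = 0`. [folklore] -/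
@[simp] theorem ev_apply_one : ev 1 = 0 := rfl

/-- `(e₄)₂ = 0`. [folklore] -/
@[simp] theorem ev_apply_two : ev 2 = 0 := rfl

/-- `(e₄)₃ = 0`. [folklore] -/
@[simp] theorem ev_apply_three : ev 3 = 0 := rfl

/-- `(e₄)₄ = 1`. [folklore] -/
@[simp] theorem ev_apply_four : ev 4 = 1 := rfl

/-- `π e₄ = 0`. [folklore] -/
@[simp] theorem projFour_ev : projFour ev = 0 := by
  ext i; fin_cases i <;> rfl

/-- Decomposition `p = ι (π p) + p₄ e₄`. [folklore] -/
theorem liftFour_projFour_add (p : 𝔼 5) : liftFour (projFour p) + p 4 • ev = p := by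
  ext i; fin_cases i <;> simp

/-- `p = ι (π p)` iff `p₄ = 0`. [folklore] -/
theorem eq_liftFour_projFour_iff (p : 𝔼 5) : p = liftFour (projFour p) ↔ p 4 = 0 := by
  constructor
  · intro h
    have := congrArg (fun v : 𝔼 5 => v 4) h
    simpa using this
  · intro h
    ext i; fin_cases i
    · rfl
    · rfl
    · rfl
    · rfl
    · simpa using h

/-- `ι` is injective. [folklore] -/
theorem liftFour_injective : Injective liftFour := fun u u' h => by
  rw [← projFour_liftFour u, ← projFour_liftFour u', h]

/-- `‖p‖² = ‖π p‖² + p₄²`. [folklore] -/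
theorem norm_sq_eq (p : 𝔼 5) : ‖p‖ ^ 2 = ‖projFour p‖ ^ 2 + p 4 ^ 2 := by
  rw [EuclideanSpace.norm_sq_eq, EuclideanSpace.norm_sq_eq, Fin.sum_univ_five, Fin.sum_univ_four]
  simp [Real.norm_eq_abs, sq_abs]

/-- The fifth coordinate functional `dv : p ↦ p₄`. [folklore] -/
abbrev vc : 𝔼 5 →L[ℝ] ℝ := EuclideanSpace.proj (4 : Fin 5)

/-- `dv p = p₄` (definitional). [folklore] -/
@[simp] theorem vc_apply (p : 𝔼 5) : vc p = p 4 := rfl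

/-- **The thickening** `G(x, y, z, w, v) = F(x, y, z, w) + v²` of a function `F` on `ℝ⁴`. [folklore] -/
def thicken₅ (F : 𝔼 4 → ℝ) (p : 𝔼 5) : ℝ := F (projFour p) + p 4 ^ 2

variable {F : 𝔼 4 → ℝ}

/-- Unfolding of the thickening. [folklore] -/
theorem thicken₅_apply (F : 𝔼 4 → ℝ) (p : 𝔼 5) : thicken₅ F p = F (projFour p) + p 4 ^ 2 := rfl

/-- `G(x, y, z, w, 0) = F(x, y, z, w)`. [folklore] -/
@[simp] theorem thicken₅_liftFour (F : 𝔼 4 → ℝ) (u : 𝔼 4) : thicken₅ F (liftFour u) = F u := by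
  simp [thicken₅]

/-- `F(π p) ≤ G(p)`. [folklore] -/
theorem le_thicken₅ (F : 𝔼 4 → ℝ) (p : 𝔼 5) : F (projFour p) ≤ thicken₅ F p := by
  rw [thicken₅_apply]; nlinarith [sq_nonneg (p 4)]

/-- **The thickening is even in `v`**: `G(x, y, z, w, -v) = G(x, y, z, w, v)`. [folklore] -/
theorem thicken₅_even (F : 𝔼 4 → ℝ) (p p' : 𝔼 5) (h0 : p' 0 = p 0) (h1 : p' 1 = p 1)
    (h2 : p' 2 = p 2) (h3 : p' 3 = p 3) (h4 : p' 4 = -p 4) : thicken₅ F p' = thicken₅ F p := by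
  simp only [thicken₅_apply]
  have hp : projFour p' = projFour p := by
    ext i; fin_cases i
    · exact h0
    · exact h1
    · exact h2
    · exact h3
  rw [hp, h4, neg_sq]

/-! ### §2 First and second derivatives of the thickening -/

/-- `p ↦ p₄²` has derivative `2 p₄ dv`. [folklore] -/
theorem hasFDerivAt_vsq (p : 𝔼 5) :
    HasFDerivAt (fun p : 𝔼 5 => p 4 ^ 2) ((2 * p 4) • (vc : 𝔼 5 →L[ℝ] ℝ)) p := by
  have h : HasFDerivAt (fun p : 𝔼 5 => (vc : 𝔼 5 →L[ℝ] ℝ) p ^ 2) _ p :=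
    (vc.hasFDerivAt (x := p)).pow 2
  refine h.congr_fderiv ?_
  ext v
  simp

/-- Chain rule for the solid part. [folklore] -/
theorem hasFDerivAt_comp_projFour {F' : 𝔼 4 →L[ℝ] ℝ} {p : 𝔼 5} (hF : HasFDerivAt F F' (projFour p)) :
    HasFDerivAt (fun p : 𝔼 5 => F (projFour p)) (F'.comp projFour) p :=
  hF.comp p projFour.hasFDerivAt

/-- **First derivative of the thickening**: `dG_p = dF_{π p} ∘ π + 2 p₄ dv`. [folklore] -/
theorem hasFDerivAt_thicken₅ {F' : 𝔼 4 →L[ℝ] ℝ} {p : 𝔼 5} (hF : HasFDerivAt F F' (projFour p)) :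
    HasFDerivAt (thicken₅ F) (F'.comp projFour + (2 * p 4) • (vc : 𝔼 5 →L[ℝ] ℝ)) p :=
  (hasFDerivAt_comp_projFour hF).add (hasFDerivAt_vsq p)

/-- `fderiv` of the thickening. [folklore] -/
theorem fderiv_thicken₅ (hF : Differentiable ℝ F) (p : 𝔼 5) :
    fderiv ℝ (thicken₅ F) p =
      (fderiv ℝ F (projFour p)).comp projFour + (2 * p 4) • (vc : 𝔼 5 →L[ℝ] ℝ) :=
  (hasFDerivAt_thicken₅ (hF (projFour p)).hasFDerivAt).fderiv

/-- The thickening of a `C^n` function is `C^n`. [folklore] -/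
theorem contDiff_thicken₅ {n : WithTop ℕ∞} (hF : ContDiff ℝ n F) : ContDiff ℝ n (thicken₅ F) :=
  (hF.comp projFour.contDiff).add ((vc.contDiff).pow 2)

/-- **The derivative of the thickening vanishes iff `dF_{π p} = 0` and `p₄ = 0`.** [folklore] -/
theorem fderiv_thicken₅_eq_zero_iff (hF : Differentiable ℝ F) (p : 𝔼 5) :
    fderiv ℝ (thicken₅ F) p = 0 ↔ fderiv ℝ F (projFour p) = 0 ∧ p 4 = 0 := by
  rw [fderiv_thicken₅ hF]
  constructor
  · intro h
    have hz : p 4 = 0 := by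
      have := congrArg (fun L : 𝔼 5 →L[ℝ] ℝ => L ev) h
      simp only [add_apply, ContinuousLinearMap.comp_apply, projFour_ev, map_zero,
        FunLike.coe_smul, Pi.smul_apply, vc_apply, ev_apply_four, smul_eq_mul, mul_one,
        zero_add, zero_apply] at this
      linarith
    refine ⟨?_, hz⟩
    refine ContinuousLinearMap.ext fun u => ?_
    have := congrArg (fun L : 𝔼 5 →L[ℝ] ℝ => L (liftFour u)) h
    simpa [hz] using this
  · rintro ⟨h1, h2⟩
    rw [h1, h2]; simp

/-- **Second derivative of the thickening**: if `fderiv F` has derivative `F''` at `π p`, then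
`fderiv (thicken₅ F)` has derivative `v ↦ F'' (π v) ∘ π + 2 v₄ dv` at `p`. [folklore] -/
theorem hasFDerivAt_fderiv_thicken₅ (hF : Differentiable ℝ F) {F'' : 𝔼 4 →L[ℝ] 𝔼 4 →L[ℝ] ℝ}
    {p : 𝔼 5} (hF2 : HasFDerivAt (fderiv ℝ F) F'' (projFour p)) :
    HasFDerivAt (fderiv ℝ (thicken₅ F))
      ((ContinuousLinearMap.precomp ℝ projFour).comp (F''.comp projFour) +
        (2 : ℝ) • (ContinuousLinearMap.smulRightL ℝ (𝔼 5) ℝ vc).comp vc) p := by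
  have h1 : HasFDerivAt (fun p : 𝔼 5 => (fderiv ℝ F (projFour p)).comp projFour)
      ((ContinuousLinearMap.precomp ℝ projFour).comp (F''.comp projFour)) p := by
    have hc : HasFDerivAt (fun p : 𝔼 5 => fderiv ℝ F (projFour p)) (F''.comp projFour) p :=
      hF2.comp p projFour.hasFDerivAt
    exact (ContinuousLinearMap.precomp ℝ projFour).hasFDerivAt.comp p hc
  have h2 : HasFDerivAt (fun p : 𝔼 5 => (2 * p 4) • (vc : 𝔼 5 →L[ℝ] ℝ))
      ((2 : ℝ) • (ContinuousLinearMap.smulRightL ℝ (𝔼 5) ℝ vc).comp vc) p := by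
    have hs : HasFDerivAt (fun p : 𝔼 5 => 2 * p 4) ((2 : ℝ) • (vc : 𝔼 5 →L[ℝ] ℝ)) p := by
      have := (vc.hasFDerivAt (x := p)).const_mul (2 : ℝ)
      simpa using this
    refine (hs.smul_const (vc : 𝔼 5 →L[ℝ] ℝ)).congr_fderiv ?_
    ext v v'
    simp [ContinuousLinearMap.smulRightL, ContinuousLinearMap.smulRight_apply]
    ring
  have h := h1.add h2
  refine h.congr_of_eventuallyEq (Eventually.of_forall fun p' => ?_)
  simp only [Pi.add_apply]
  exact fderiv_thicken₅ hF p'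

/-- **The Hessian of the thickening, evaluated**: for `F` of class `C²`,
`D²G_p(v, v') = D²F_{π p}(π v, π v') + 2 v₄ v'₄`. [folklore] -/
theorem fderiv_fderiv_thicken₅_apply (hF : ContDiff ℝ 2 F) (p v v' : 𝔼 5) :
    fderiv ℝ (fderiv ℝ (thicken₅ F)) p v v' =
      fderiv ℝ (fderiv ℝ F) (projFour p) (projFour v) (projFour v') + 2 * v 4 * v' 4 := by
  have hd : Differentiable ℝ F := hF.differentiable (by norm_num)
  have hd2 : DifferentiableAt ℝ (fderiv ℝ F) (projFour p) := by
    have : ContDiff ℝ 1 (fderiv ℝ F) := hF.fderiv_right (by norm_num)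
    exact (this.differentiable (by norm_num)) _
  rw [(hasFDerivAt_fderiv_thicken₅ hd hd2.hasFDerivAt).fderiv]
  simp [ContinuousLinearMap.smulRightL, ContinuousLinearMap.smulRight_apply,
    ContinuousLinearMap.precomp]
  ring

/-! ### §3 Morse data of the thickening -/

/-- A Morse function on the model space `ℝ⁴` is smooth. [folklore] -/
theorem contDiff_of_isMorse (hF : IsMorse (𝓡 4) F) : ContDiff ℝ ∞ F :=
  contMDiff_iff_contDiff.1 hF.1

/-- **Critical points of the thickening**: `p` is critical for `G = F ∘ π + v²` iff `π p` is
critical for `F` and `p₄ = 0`. [folklore] -/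
theorem isMCriticalPt_thicken₅_iff (hF : Differentiable ℝ F) (p : 𝔼 5) :
    IsMCriticalPt (𝓡 5) (thicken₅ F) p ↔ IsMCriticalPt (𝓡 4) F (projFour p) ∧ p 4 = 0 := by
  rw [MorseBirth.isMCriticalPt_iff_fderiv, MorseBirth.isMCriticalPt_iff_fderiv,
    fderiv_thicken₅_eq_zero_iff hF]

/-- The critical points of the thickening are the lifts `(x, y, z, w, 0)` of the critical points
`(x, y, z, w)` of `F`. [folklore] -/
theorem isMCriticalPt_thicken₅_iff' (hF : Differentiable ℝ F) (p : 𝔼 5) :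
    IsMCriticalPt (𝓡 5) (thicken₅ F) p ↔ ∃ u, IsMCriticalPt (𝓡 4) F u ∧ p = liftFour u := by
  rw [isMCriticalPt_thicken₅_iff hF]
  constructor
  · rintro ⟨h1, h2⟩
    exact ⟨projFour p, h1, (eq_liftFour_projFour_iff p).2 h2⟩
  · rintro ⟨u, hu, rfl⟩
    exact ⟨by simpa using hu, rfl⟩

/-- `crit G = ι (crit F)`. [folklore] -/
theorem criticalSet_thicken₅ (hF : Differentiable ℝ F) :
    criticalSet (𝓡 5) (thicken₅ F) = liftFour '' criticalSet (𝓡 4) F := by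
  ext p
  simp only [mem_criticalSet, isMCriticalPt_thicken₅_iff' hF, mem_image]
  constructor
  · rintro ⟨u, hu, rfl⟩; exact ⟨u, hu, rfl⟩
  · rintro ⟨u, hu, rfl⟩; exact ⟨u, hu, rfl⟩

/-- **The Hessian of the thickening**: `Hess G_p (v, v') = Hess F_{π p} (π v, π v') + 2 v₄ v'₄`
(on the model vector space the Hessian of `Literature.Topology.FourManifolds.mhessian` is the
second Fréchet derivative, `Literature.Topology.FourManifolds.MorseBirth.mhessian_model_apply`).
[folklore] -/
theorem mhessian_thicken₅_apply (hF : ContDiff ℝ 2 F) (p v v' : 𝔼 5) :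
    mhessian (𝓡 5) (thicken₅ F) p v v' =
      mhessian (𝓡 4) F (projFour p) (projFour v) (projFour v') + 2 * v 4 * v' 4 := by
  rw [MorseBirth.mhessian_model_apply, MorseBirth.mhessian_model_apply,
    fderiv_fderiv_thicken₅_apply hF]

/-- **Nondegeneracy transfers to the thickening**: if `Hess F_{π p}` is nondegenerate, so is
`Hess G_p`. [folklore] -/
theorem nondegenerate_mhessian_thicken₅ (hF : ContDiff ℝ 2 F) {p : 𝔼 5}
    (h : (mhessian (𝓡 4) F (projFour p)).Nondegenerate) :
    (mhessian (𝓡 5) (thicken₅ F) p).Nondegenerate := by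
  refine ⟨fun v hv => ?_, fun v hv => ?_⟩
  · have hz : v 4 = 0 := by
      have h1 := hv ev
      rw [mhessian_thicken₅_apply hF] at h1
      simp only [projFour_ev, map_zero, ev_apply_four, mul_one, zero_add] at h1
      linarith
    have hπ : projFour v = 0 := h.1 (projFour v) fun u => by
      have h1 := hv (liftFour u)
      rw [mhessian_thicken₅_apply hF] at h1
      simpa [hz] using h1
    rw [← liftFour_projFour_add v, hπ, hz]; simp
  · have hz : v 4 = 0 := by
      have h1 := hv ev
      rw [mhessian_thicken₅_apply hF] at h1
      simp only [projFour_ev, map_zero, LinearMap.zero_apply, ev_apply_four, mul_one, zero_add] at h1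
      linarith
    have hπ : projFour v = 0 := h.2 (projFour v) fun u => by
      have h1 := hv (liftFour u)
      rw [mhessian_thicken₅_apply hF] at h1
      simpa [hz] using h1
    rw [← liftFour_projFour_add v, hπ, hz]; simp

/-- **The thickening of a Morse function on `ℝ⁴` is a Morse function on `ℝ⁵`.** [folklore] -/
theorem isMorse_thicken₅ (hF : IsMorse (𝓡 4) F) : IsMorse (𝓡 5) (thicken₅ F) := by
  have hs : ContDiff ℝ ∞ F := contDiff_of_isMorse hF
  have hd : Differentiable ℝ F := hs.differentiable (by simp)
  refine ⟨contMDiff_iff_contDiff.2 (contDiff_thicken₅ hs), fun p hp => ?_⟩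
  rw [isMCriticalPt_thicken₅_iff hd] at hp
  exact nondegenerate_mhessian_thicken₅ (hs.of_le (by norm_cast)) (hF.2 _ hp.1)

/-- **The Morse index is unchanged by thickening**: `index_G (p) = index_F (π p)` (the Hessian
of `G` is that of `F` plus the positive square `2 v²` split off along `π`,
`Literature.Topology.FourManifolds.sigNeg_eq_of_proj`).  Milnor, *Morse theory* (1963), §2.
[cite: Milnor1963, §2] -/
theorem morseIndex_thicken₅ (hF : ContDiff ℝ 2 F) (p : 𝔼 5) :
    morseIndex (𝓡 5) (thicken₅ F) p = morseIndex (𝓡 4) F (projFour p) := by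
  unfold morseIndex
  refine sigNeg_eq_of_proj _ _ (projFour : 𝔼 5 →L[ℝ] 𝔼 4).toLinearMap
    (liftFour : 𝔼 4 →L[ℝ] 𝔼 5).toLinearMap (fun v => ?_) (fun v hv => ?_) (fun w => ?_) (fun w => ?_)
  · simp only [LinearMap.BilinMap.toQuadraticMap_apply, ContinuousLinearMap.coe_coe,
      mhessian_thicken₅_apply hF]
    nlinarith [sq_nonneg (v 4)]
  · simp only [ContinuousLinearMap.coe_coe] at hv
    simp only [LinearMap.BilinMap.toQuadraticMap_apply, mhessian_thicken₅_apply hF, hv, map_zero,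
      zero_add]
    nlinarith [sq_nonneg (v 4)]
  · simp [LinearMap.BilinMap.toQuadraticMap_apply, mhessian_thicken₅_apply hF]
  · simp

/-- `Crit_i(G) = ι (Crit_i(F))` for every index `i`. [folklore] -/
theorem criticalSetOfIndex_thicken₅ (hF : ContDiff ℝ 2 F) (i : ℕ) :
    criticalSetOfIndex (𝓡 5) (thicken₅ F) i = liftFour '' criticalSetOfIndex (𝓡 4) F i := by
  have hd : Differentiable ℝ F := hF.differentiable (by norm_num)
  ext p
  simp only [mem_criticalSetOfIndex, mem_image, isMCriticalPt_thicken₅_iff' hd]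
  constructor
  · rintro ⟨⟨u, hu, rfl⟩, hi⟩
    refine ⟨u, ⟨hu, ?_⟩, rfl⟩
    rwa [morseIndex_thicken₅ hF, projFour_liftFour] at hi
  · rintro ⟨u, ⟨hu, hi⟩, rfl⟩
    refine ⟨⟨u, hu, rfl⟩, ?_⟩
    rwa [morseIndex_thicken₅ hF, projFour_liftFour]

/-- Critical points of index `i` below the level `c` correspond under `ι`. [folklore] -/
theorem criticalSetOfIndex_thicken₅_inter (hF : ContDiff ℝ 2 F) (i : ℕ) (c : ℝ) :
    criticalSetOfIndex (𝓡 5) (thicken₅ F) i ∩ thicken₅ F ⁻¹' Iic c =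
      liftFour '' (criticalSetOfIndex (𝓡 4) F i ∩ F ⁻¹' Iic c) := by
  rw [criticalSetOfIndex_thicken₅ hF]
  ext p
  simp only [mem_inter_iff, mem_preimage, mem_Iic, mem_image]
  constructor
  · rintro ⟨⟨u, hu, rfl⟩, hc⟩
    exact ⟨u, ⟨hu, by simpa using hc⟩, rfl⟩
  · rintro ⟨u, ⟨hu, hc⟩, rfl⟩
    exact ⟨⟨u, hu, rfl⟩, by simpa using hc⟩

end SolidThickeningFive

/-! ### §4 The `5`-dimensional `1`-handlebodies `{q(x, y) + z² + w² + v² ≤ c}` -/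

open PlanarThickening SolidThickening SolidThickeningFive

namespace IsHoledDiscMorseFunction

variable {g : ℕ} {q : 𝔼 2 → ℝ} {c : ℝ} (h : IsHoledDiscMorseFunction g q c)
include h

/-- The thrice-thickened function `G = q(x, y) + z² + w² + v²` is a Morse function on `ℝ⁵`.
[folklore] -/
theorem isMorse_thicken₅_thicken₄_thicken : IsMorse (𝓡 5) (thicken₅ (thicken₄ (thicken q))) :=
  isMorse_thicken₅ h.isMorse_thicken₄_thicken

/-- The critical points of `G = q + z² + w² + v²` are the points `(x, y, 0, 0, 0)` with
`(x, y)` critical for `q`. [folklore] -/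
theorem isMCriticalPt_thicken₅_iff (p : 𝔼 5) :
    IsMCriticalPt (𝓡 5) (thicken₅ (thicken₄ (thicken q))) p ↔
      ∃ u, IsMCriticalPt (𝓡 2) q u ∧ p = liftFour (lift₃ (lift u)) := by
  have hF : Differentiable ℝ (thicken₄ (thicken q)) :=
    (contDiff_thicken₄ (contDiff_thicken (contDiff_of_isMorse h.isMorse))).differentiable
      (by simp)
  rw [isMCriticalPt_thicken₅_iff' hF]
  constructor
  · rintro ⟨v, hv, rfl⟩
    obtain ⟨u, hu, rfl⟩ := (h.isMCriticalPt_thicken₄_thicken_iff v).1 hv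
    exact ⟨u, hu, rfl⟩
  · rintro ⟨u, hu, rfl⟩
    exact ⟨lift₃ (lift u), (h.isMCriticalPt_thicken₄_thicken_iff _).2 ⟨u, hu, rfl⟩, rfl⟩

/-- **`c` is a regular level of `G = q + z² + w² + v²`.** [folklore] -/
theorem isRegularLevel₅ : IsRegularLevel (𝓡 5) (thicken₅ (thicken₄ (thicken q))) c := by
  refine h.isMorse_thicken₅_thicken₄_thicken.isRegularLevel fun p hp => ?_
  obtain ⟨u, hu, rfl⟩ := (h.isMCriticalPt_thicken₅_iff p).1 hp
  rw [thicken₅_liftFour, thicken₄_lift₃, thicken_lift]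
  exact h.apply_ne_of_isMCriticalPt hu

/-- **The thrice-thickened planar domain** `{q + z² + w² + v² ≤ c} ⊂ ℝ⁵`, a regular sublevel
set (a smooth compact `5`-manifold with boundary the level hypersurface). [folklore] -/
abbrev FiveThickening : Type := RegularSublevel h.isRegularLevel₅

/-- A priori bound: `‖p‖² ≤ c + B` on `{G ≤ c}`. [folklore] -/
theorem norm_sq_le_of_thicken₅_le :
    ∃ B : ℝ, ∀ p : 𝔼 5, thicken₅ (thicken₄ (thicken q)) p ≤ c → ‖p‖ ^ 2 ≤ c + B := by
  obtain ⟨B, hB⟩ := h.exists_bound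
  refine ⟨B, fun p hp => ?_⟩
  rw [SolidThickeningFive.norm_sq_eq, SolidThickening.norm_sq_eq, PlanarThickening.norm_sq_eq]
  have := hB (proj (proj₃ (projFour p)))
  rw [thicken₅_apply, thicken₄_apply, thicken_apply] at hp
  linarith

/-- **`{G ≤ c}` is compact** (closed and bounded). [folklore] -/
theorem isCompact_preimage₅ : IsCompact (thicken₅ (thicken₄ (thicken q)) ⁻¹' Iic c) := by
  obtain ⟨B, hB⟩ := h.norm_sq_le_of_thicken₅_le
  have hcont : Continuous (thicken₅ (thicken₄ (thicken q))) :=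
    (contDiff_thicken₅ (contDiff_thicken₄ (contDiff_thicken (contDiff_of_isMorse h.isMorse)))).continuous
  refine Metric.isCompact_of_isClosed_isBounded (isClosed_Iic.preimage hcont) ?_
  rw [isBounded_iff_forall_norm_le]
  refine ⟨|c + B| + 1, fun p hp => ?_⟩
  have h1 : ‖p‖ ^ 2 ≤ c + B := hB p hp
  nlinarith [norm_nonneg p, abs_nonneg (c + B), le_abs_self (c + B), sq_nonneg (‖p‖ - 1)]

/-- `{G ≤ c}` is compact. [folklore] -/
instance compactSpace_fiveThickening : CompactSpace h.FiveThickening :=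
  RegularSublevel.compactSpace_of_isCompact _ h.isCompact_preimage₅

/-- The handle count of `{G ≤ c}`: one critical point of index `0` and `g` of index `1` below
`c`, nothing else. [folklore] -/
theorem ncard_criticalSetOfIndex_inter₅ (i : ℕ) :
    (criticalSetOfIndex (𝓡 5) (thicken₅ (thicken₄ (thicken q))) i ∩
      thicken₅ (thicken₄ (thicken q)) ⁻¹' Iic c).ncard = handleCount 1 g i := by
  have hs : ContDiff ℝ 2 (thicken₄ (thicken q)) :=
    (contDiff_thicken₄ (contDiff_thicken (contDiff_of_isMorse h.isMorse))).of_le (by norm_cast)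
  rw [criticalSetOfIndex_thicken₅_inter hs, ncard_image_of_injective _ liftFour_injective,
    h.ncard_criticalSetOfIndex_inter₄ i]

/-- `{G ≤ c}` is connected: one critical point of index `0` (Reeb's argument).
[cite: Milnor1963, §3 and proof of Thm. 4.1] -/
instance connectedSpace_fiveThickening : ConnectedSpace h.FiveThickening := by
  have hs : ContDiff ℝ 2 (thicken₄ (thicken q)) :=
    (contDiff_thicken₄ (contDiff_thicken (contDiff_of_isMorse h.isMorse))).of_le (by norm_cast)
  have hs' : ContDiff ℝ 2 (thicken q) :=
    (contDiff_thicken (contDiff_of_isMorse h.isMorse)).of_le (by norm_cast)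
  have hq : ContDiff ℝ 2 q := (contDiff_of_isMorse h.isMorse).of_le (by norm_cast)
  obtain ⟨u₀, h0, hc⟩ := h.exists_index_zero
  refine RegularSublevel.connectedSpace_of_isCompact _ h.isCompact_preimage₅ ?_
    ⟨liftFour (lift₃ (lift u₀)), by rw [thicken₅_liftFour, thicken₄_lift₃, thicken_lift]; exact hc.le⟩
  rw [criticalSetOfIndex_thicken₅ hs, criticalSetOfIndex_thicken₄ hs', criticalSetOfIndex_thicken hq,
    h0, image_singleton, image_singleton, image_singleton]
  exact subsingleton_singleton

/-- `{G ≤ c}` is orientable (a codimension-`0` submanifold of `ℝ⁵`). [folklore] -/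
theorem isOrientable_fiveThickening : IsOrientable (𝓡∂ 5) h.FiveThickening :=
  RegularSublevel.isOrientable _ (isOrientable_euclideanSpace 5)

/-- **`{G ≤ c}` has a handle decomposition with one `0`-handle and `g` `1`-handles.**
[cite: Milnor1963, Thms. 3.1–3.2] -/
theorem hasHandleDecomposition_fiveThickening :
    HasHandleDecomposition 4 h.FiveThickening (handleCount 1 g) := by
  have hd := RegularSublevel.hasHandleDecomposition h.isMorse_thicken₅_thicken₄_thicken
    h.isRegularLevel₅
  have hfun : (fun i => (criticalSetOfIndex (𝓡 5) (thicken₅ (thicken₄ (thicken q))) i ∩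
      thicken₅ (thicken₄ (thicken q)) ⁻¹' Iic c).ncard) = handleCount 1 g :=
    funext h.ncard_criticalSetOfIndex_inter₅
  rw [hfun] at hd
  exact hd

/-- `{G ≤ c}` is a handlebody with handles of index `≤ 1`. [cite: Milnor1963, Thms. 3.1–3.2] -/
theorem isHandlebodyOfIndexLE_fiveThickening : IsHandlebodyOfIndexLE 4 1 h.FiveThickening :=
  HasHandleDecomposition.isHandlebodyOfIndexLE_holds (n := 4) (k := 1) (W := h.FiveThickening)
    h.hasHandleDecomposition_fiveThickening fun j hj => handleCount_of_two_le 1 g (by omega)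

end IsHoledDiscMorseFunction

/-- **Compact connected orientable `5`-dimensional `1`-handlebodies with one `0`-handle and `k`
`1`-handles exist for every `k`** (in `Type`, Hausdorff and second countable: regular sublevel
sets `{q(x, y) + z² + w² + v² ≤ c}` of `ℝ⁵` for the thrice-thickened planar Morse functions of
`exists_isHoledDiscMorseFunction`), so the 1-handlebodies `V` of the presentation 5-manifolds
`H⁵(P, ε)` (`PresentationHandlebodyFive`) exist in every genus and — by the classification
`nonempty_diffeomorph_of_hasHandleDecomposition_handleCount_one_of_handles'` — are all
diffeomorphic to these models; classically `♮ᵏ(S¹ × B⁴) = B⁵ ∪ k` 1-handles (Kirby 1989,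
Ch. I, p. 18; Kosinski 1993, VI §11). [cite: Kirby1989, Ch. I, p. 18] -/
theorem exists_oneHandlebody_five (k : ℕ) :
    ∃ (V : Type) (_ : TopologicalSpace V) (_ : T2Space V) (_ : SecondCountableTopology V)
      (_ : CompactSpace V) (_ : ConnectedSpace V) (_ : ChartedSpace (EuclideanHalfSpace 5) V)
      (_ : IsManifold (𝓡∂ 5) ∞ V),
      IsOrientable (𝓡∂ 5) V ∧ HasHandleDecomposition 4 V (handleCount 1 k) ∧
        IsHandlebodyOfIndexLE 4 1 V := by
  obtain ⟨q, c, h⟩ := exists_isHoledDiscMorseFunction k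
  exact ⟨h.FiveThickening, inferInstance, inferInstance, inferInstance, h.compactSpace_fiveThickening,
    h.connectedSpace_fiveThickening, inferInstance, inferInstance, h.isOrientable_fiveThickening,
    h.hasHandleDecomposition_fiveThickening, h.isHandlebodyOfIndexLE_fiveThickening⟩

end Literature.Topology.FourManifolds
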